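import Summits.AtomisticToContinuum.Crystallization.Theorems.ChartedPlanarOrderNashForceBalance

/-!
# Nash force balance — part 2/2: summability of inverse sixth powers over a separated set; regrouping the force series by layers
(decomp-a2c lens-3 g22 `NashForceBalance.lean` sha256 28ae3ac7…, lines 273–522, split into two modules at the gate's 400-line limit; content
byte-identical; namespace kept `…ChartedPlanarOrderNashForceBalance`).  Imports part 1.
-/

noncomputable section

open MeasureTheory Set Metric Filter Topology
open scoped RealInnerProductSpace
open Summit.AtomisticToContinuum.Crystallization.Theorems.ChartedPlanarOrderRigidityDoor
open Summit.AtomisticToContinuum.Crystallization.Theorems.ChartedPlanarOrderDensityDichotomy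
open Summit.AtomisticToContinuum.Crystallization.Theorems.ChartedPlanarOrderMesoCut
open Summit.AtomisticToContinuum.Crystallization.Theorems.ChartedPlanarOrderProfileSlavingLJ (pairForce layerForce IsStacked)
open Summit.AtomisticToContinuum.Crystallization.Theorems.ChartedPlanarOrderDoorLayered (Layered)
open Literature.MathematicalPhysics.StatisticalMechanics (lennardJones)

namespace Summit.AtomisticToContinuum.Crystallization.Theorems.ChartedPlanarOrderNashForceBalance

/-! ## 4. Inverse sixth powers of the distances are summable over a separated set (grid injection + product comparison) -/

section Summable6

variable {δ : ℝ} {S : Set E3} {p : E3}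

/-- the comparison weight on `ℤ`: `b k = (1 + |k|)⁻²`. -/
def bWeight (k : ℤ) : ℝ := ((1 + |(k : ℝ)|) ^ 2)⁻¹

/-- the comparison weight is nonnegative. -/
theorem bWeight_nonneg (k : ℤ) : 0 ≤ bWeight k := by unfold bWeight; positivity

/-- the comparison weight `bWeight` is summable over `ℤ`. -/
theorem summable_bWeight : Summable bWeight := by
  have hnat : Summable (fun n : ℕ => ((1 + (n : ℝ)) ^ 2)⁻¹) := by
    have h := (summable_nat_add_iff 1).mpr (Real.summable_nat_pow_inv.mpr (by norm_num : 1 < 2))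
    refine h.congr fun n => ?_
    push_cast
    ring
  rw [summable_int_iff_summable_nat_and_neg]
  constructor
  · refine hnat.congr fun n => ?_
    simp [bWeight, Nat.abs_cast]
  · refine hnat.congr fun n => ?_
    simp [bWeight, abs_neg, Nat.abs_cast]

/-- a shifted comparison weight is summable. -/
theorem summable_bWeight_shift (k₀ : ℤ) : Summable (fun k : ℤ => bWeight (k - k₀)) :=
  (Equiv.subRight k₀).summable_iff.mpr summable_bWeight

/-- the product weight on `ℤ³` centred at `k₀`. -/
def vWeight (k₀ k : ℤ × ℤ × ℤ) : ℝ := bWeight (k.1 - k₀.1) * (bWeight (k.2.1 - k₀.2.1) * bWeight (k.2.2 - k₀.2.2))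

/-- the product weight is nonnegative. -/
theorem vWeight_nonneg (k₀ k : ℤ × ℤ × ℤ) : 0 ≤ vWeight k₀ k := by
  unfold vWeight; exact mul_nonneg (bWeight_nonneg _) (mul_nonneg (bWeight_nonneg _) (bWeight_nonneg _))
set_option maxHeartbeats 400000 in
/-- the product weight is summable over `ℤ³`. -/
theorem summable_vWeight (k₀ : ℤ × ℤ × ℤ) : Summable (vWeight k₀) := by
  have h23 : Summable (fun k : ℤ × ℤ => bWeight (k.1 - k₀.2.1) * bWeight (k.2 - k₀.2.2)) :=
    (summable_bWeight_shift k₀.2.1).mul_of_nonneg (summable_bWeight_shift k₀.2.2) (fun _ => bWeight_nonneg _)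
      (fun _ => bWeight_nonneg _)
  exact (summable_bWeight_shift k₀.1).mul_of_nonneg h23 (fun _ => bWeight_nonneg _)
    (fun k => mul_nonneg (bWeight_nonneg _) (bWeight_nonneg _))

/-- the grid map: integer parts of the coordinates at scale `δ/2`. -/
def grid (δ : ℝ) (q : E3) : ℤ × ℤ × ℤ := (⌊2 / δ * q.ofLp 0⌋, ⌊2 / δ * q.ofLp 1⌋, ⌊2 / δ * q.ofLp 2⌋)

/-- floors at distance `< 1` in every coordinate ⇒ the points are closer than `δ`. -/
theorem abs_sub_lt_of_floor_eq (hδ : 0 < δ) {a b : ℝ} (h : ⌊2 / δ * a⌋ = ⌊2 / δ * b⌋) : |a - b| < δ / 2 := by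
  have h1 := Int.abs_sub_lt_one_of_floor_eq_floor h
  rw [← mul_sub, abs_mul, abs_of_pos (by positivity : (0 : ℝ) < 2 / δ)] at h1
  have : 2 / δ * |a - b| < 2 / δ * (δ / 2) := by rw [show 2 / δ * (δ / 2) = 1 by field_simp]; exact h1
  exact lt_of_mul_lt_mul_left this (by positivity)

/-- `‖v‖²` is the sum of the three squared coordinates. -/
theorem norm_sq_eq_sum (v : E3) : ‖v‖ ^ 2 = (v.ofLp 0) ^ 2 + (v.ofLp 1) ^ 2 + (v.ofLp 2) ^ 2 := by
  rw [EuclideanSpace.real_norm_sq_eq, Fin.sum_univ_three]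

/-- the grid map is injective on a `δ`-separated set. -/
theorem grid_injOn (hδ : 0 < δ) (hS : IsSep δ S) : Set.InjOn (grid δ) S := by
  intro q hq q' hq' h
  simp only [grid, Prod.mk.injEq] at h
  obtain ⟨h0, h1, h2⟩ := h
  have e0 := abs_sub_lt_of_floor_eq hδ h0
  have e1 := abs_sub_lt_of_floor_eq hδ h1
  have e2 := abs_sub_lt_of_floor_eq hδ h2
  by_contra hne
  have hd : δ ≤ ‖q - q'‖ := by rw [← dist_eq_norm]; exact hS q hq q' hq' hne
  have hsq : ‖q - q'‖ ^ 2 = (q.ofLp 0 - q'.ofLp 0) ^ 2 + (q.ofLp 1 - q'.ofLp 1) ^ 2 + (q.ofLp 2 - q'.ofLp 2) ^ 2 := by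
    rw [norm_sq_eq_sum]; rfl
  have a0 : (q.ofLp 0 - q'.ofLp 0) ^ 2 < (δ / 2) ^ 2 := by
    have := sq_lt_sq' (abs_lt.mp e0).1 (abs_lt.mp e0).2; simpa using this
  have a1 : (q.ofLp 1 - q'.ofLp 1) ^ 2 < (δ / 2) ^ 2 := by
    have := sq_lt_sq' (abs_lt.mp e1).1 (abs_lt.mp e1).2; simpa using this
  have a2 : (q.ofLp 2 - q'.ofLp 2) ^ 2 < (δ / 2) ^ 2 := by
    have := sq_lt_sq' (abs_lt.mp e2).1 (abs_lt.mp e2).2; simpa using this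
  have hδ2 : δ ^ 2 ≤ ‖q - q'‖ ^ 2 := pow_le_pow_left₀ hδ.le hd 2
  nlinarith

/-- coordinate control: `1 + |grid(q)ᵢ − grid(p)ᵢ| ≤ (4/δ) ‖p − q‖` once `‖p − q‖ ≥ δ`. -/
theorem one_add_abs_sub_floor_le (hδ : 0 < δ) {a b r : ℝ} (hab : |a - b| ≤ r) (hr : δ ≤ r) :
    1 + |((⌊2 / δ * a⌋ - ⌊2 / δ * b⌋ : ℤ) : ℝ)| ≤ 4 / δ * r := by
  have hc : (0 : ℝ) < 2 / δ := by positivity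
  have hAB : |2 / δ * a - 2 / δ * b| = 2 / δ * |a - b| := by rw [← mul_sub, abs_mul, abs_of_pos hc]
  have hfl : |((⌊2 / δ * a⌋ - ⌊2 / δ * b⌋ : ℤ) : ℝ)| ≤ |2 / δ * a - 2 / δ * b| + 1 := by
    have h1 := Int.floor_le (2 / δ * a)
    have h2 := Int.lt_floor_add_one (2 / δ * a)
    have h3 := Int.floor_le (2 / δ * b)
    have h4 := Int.lt_floor_add_one (2 / δ * b)
    have h5 := le_abs_self (2 / δ * a - 2 / δ * b)
    have h6 := neg_abs_le (2 / δ * a - 2 / δ * b)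
    push_cast
    rw [abs_le]
    constructor <;> linarith
  rw [hAB] at hfl
  have h2r : (2 : ℝ) ≤ 2 / δ * r := by
    rw [show (2 : ℝ) / δ * r = 2 * (r / δ) by ring]
    have : 1 ≤ r / δ := (one_le_div hδ).mpr hr
    linarith
  have h3 : 2 / δ * |a - b| ≤ 2 / δ * r := mul_le_mul_of_nonneg_left hab hc.le
  have h4 : 4 / δ * r = 2 * (2 / δ * r) := by ring
  linarith

/-- a coordinate difference is bounded by the norm of the difference. -/
theorem abs_coord_sub_le_norm (v w : E3) (i : Fin 3) : |v.ofLp i - w.ofLp i| ≤ ‖v - w‖ := by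
  have h := PiLp.norm_apply_le (v - w) i
  rw [Real.norm_eq_abs] at h
  simpa using h

/-- ★ the termwise comparison `‖p − q‖⁻⁶ ≤ (4/δ)⁶ · v(grid q)`. -/
theorem inv_pow_six_le_vWeight (hδ : 0 < δ) {q : E3} (hpq : δ ≤ ‖p - q‖) :
    (‖p - q‖⁻¹) ^ 6 ≤ (4 / δ) ^ 6 * vWeight (grid δ p) (grid δ q) := by
  have hρ : 0 < ‖p - q‖ := lt_of_lt_of_le hδ hpq
  have hqp : ‖q - p‖ = ‖p - q‖ := norm_sub_rev _ _
  have hi : ∀ i : Fin 3, 1 + |(((⌊2 / δ * q.ofLp i⌋ - ⌊2 / δ * p.ofLp i⌋ : ℤ)) : ℝ)| ≤ 4 / δ * ‖p - q‖ := fun i =>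
    one_add_abs_sub_floor_le hδ ((abs_coord_sub_le_norm q p i).trans hqp.le) hpq
  have hpos : ∀ i : Fin 3, 0 < 1 + |(((⌊2 / δ * q.ofLp i⌋ - ⌊2 / δ * p.ofLp i⌋ : ℤ)) : ℝ)| := fun i => by positivity
  -- each factor: ((1+|kᵢ|)²)⁻¹ ≥ ((4/δ)‖p−q‖)⁻²
  have hfac : ∀ i : Fin 3, ((4 / δ * ‖p - q‖) ^ 2)⁻¹ ≤ bWeight (⌊2 / δ * q.ofLp i⌋ - ⌊2 / δ * p.ofLp i⌋) := fun i => by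
    unfold bWeight
    push_cast
    have := hi i
    push_cast at this
    have h0 := hpos i
    push_cast at h0
    exact inv_anti₀ (by positivity) (pow_le_pow_left₀ h0.le this 2)
  have hc : 0 < 4 / δ * ‖p - q‖ := by positivity
  have key : (‖p - q‖⁻¹) ^ 6 = (4 / δ) ^ 6 * (((4 / δ * ‖p - q‖) ^ 2)⁻¹ * (((4 / δ * ‖p - q‖) ^ 2)⁻¹ * ((4 / δ * ‖p - q‖) ^ 2)⁻¹)) := by
    field_simp
  rw [key]
  apply mul_le_mul_of_nonneg_left _ (by positivity)
  unfold vWeight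
  simp only [grid]
  have hb0 : 0 ≤ ((4 / δ * ‖p - q‖) ^ 2)⁻¹ := by positivity
  exact mul_le_mul (hfac 0) (mul_le_mul (hfac 1) (hfac 2) hb0 (bWeight_nonneg _)) (mul_nonneg hb0 hb0) (bWeight_nonneg _)

/-- ★ **inverse sixth powers are summable over a separated set**. -/
theorem summable_inv_pow_six (hδ : 0 < δ) (hS : IsSep δ S) (hp : p ∈ S) :
    Summable (fun q : Others S p => (‖p - (q : E3)‖⁻¹) ^ 6) := by
  have hinj : Function.Injective (fun q : Others S p => grid δ (q : E3)) := by
    intro q q' h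
    exact Subtype.ext (grid_injOn hδ hS (mem_of_others q) (mem_of_others q') h)
  have hv : Summable (fun q : Others S p => (4 / δ) ^ 6 * vWeight (grid δ p) (grid δ (q : E3))) :=
    (((summable_vWeight (grid δ p)).mul_left ((4 / δ) ^ 6)).comp_injective hinj)
  refine Summable.of_nonneg_of_le (fun q => by positivity) (fun q => ?_) hv
  exact inv_pow_six_le_vWeight hδ (le_norm_sub_of_others hS hp q)

/-- ★ **Nash force balance, unconditional form**: at every atom of a `δ`-separated single-site-Nash configuration the LJ pair forces
from all other atoms sum to zero. -/
theorem nash_force_balance (hδ : 0 < δ) (hS : IsSep δ S) (hN : IsNash (μS S)) (hp : p ∈ S) :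
    HasSum (fun q : Others S p => pairForce (p - q)) 0 :=
  hasSum_pairForce_of_isNash hδ hS hN hp (summable_inv_pow_six hδ hS hp)

end Summable6


/-! ## 5. Stacked layered door sets: regrouping the convergent force series by layers -/

section Layers

variable {δ : ℝ} {a b : E3} {w : ℤ → E3}

/-- the pair force vanishes at `0` (junk value). -/
theorem pairForce_zero : pairForce 0 = 0 := by simp [pairForce]

/-- the layered parametrisation `(l, i, j) ↦ (i a + j b) + w l`. -/
def layerPoint (a b : E3) (w : ℤ → E3) (t : ℤ × ℤ × ℤ) : E3 := ((t.2.1 : ℝ) • a + (t.2.2 : ℝ) • b) + w t.1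

/-- every layer point lies in the layered set. -/
theorem layerPoint_mem (t : ℤ × ℤ × ℤ) : layerPoint a b w t ∈ Layered a b w := ⟨t.1, t.2.1, t.2.2, rfl⟩

/-- the layer point `(m, 0, 0)` is the offset `w m`. -/
theorem layerPoint_self (m : ℤ) : layerPoint a b w (m, 0, 0) = w m := by simp [layerPoint]

/-- heights along the stacking normal are strictly increasing in the layer index. -/
theorem strictMono_height {n : E3} (hn : ∀ m : ℤ, 0 < ⟪n, w (m + 1) - w m⟫) : StrictMono fun l => ⟪n, w l⟫ :=
  strictMono_int_of_lt_succ fun l => by have := hn l; rw [inner_sub_right] at this; linarith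

/-- the parametrisation is injective for independent periods and a stacked profile. -/
theorem layerPoint_injective (hab : LinearIndependent ℝ ![a, b]) (hst : IsStacked a b w) :
    Function.Injective (layerPoint a b w) := by
  obtain ⟨n, hna, hnb, hn⟩ := hst
  have hmono := strictMono_height hn
  intro t t' h
  have hh : ⟪n, layerPoint a b w t⟫ = ⟪n, layerPoint a b w t'⟫ := by rw [h]
  simp only [layerPoint, inner_add_right, inner_smul_right, hna, hnb, mul_zero, zero_add] at hh
  have h1 : t.1 = t'.1 := hmono.injective hh
  have h2 : ((t.2.1 : ℝ) - t'.2.1) • a + ((t.2.2 : ℝ) - t'.2.2) • b = 0 := by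
    have : layerPoint a b w t - layerPoint a b w t' = 0 := sub_eq_zero.mpr h
    rw [← this]; simp only [layerPoint, h1, sub_smul]; abel
  have h3 := (LinearIndependent.pair_iff.mp hab) _ _ h2
  have h21 : t.2.1 = t'.2.1 := by exact_mod_cast sub_eq_zero.mp h3.1
  have h22 : t.2.2 = t'.2.2 := by exact_mod_cast sub_eq_zero.mp h3.2
  exact Prod.ext h1 (Prod.ext h21 h22)

/-- ★ **layer-resolved Nash force balance** (the analytic content of D1a `LayerForceBalance`): for independent periods, a stacked
profile, a `δ`-separated single-site-Nash layered set, and `layerForce a b 0 = 0` (the in-layer cancellation, = `layerForce_neg` at `0`),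
the forces exerted on the atom `w m` by the OTHER layers — each a convergent 2D lattice sum `layerForce a b (w m − w l)` — sum to zero. -/
theorem hasSum_layerForce_of_isNash (hδ : 0 < δ) (hab : LinearIndependent ℝ ![a, b]) (hst : IsStacked a b w)
    (hS : IsSep δ (Layered a b w)) (hN : IsNash (μS (Layered a b w))) (h0 : layerForce a b 0 = 0) (m : ℤ) :
    HasSum (fun l : {l : ℤ // l ≠ m} => layerForce a b (w m - w l)) 0 := by
  have hinj := layerPoint_injective hab hst
  have hp : w m ∈ Layered a b w := ⟨m, 0, 0, by simp⟩
  have hbal := nash_force_balance hδ hS hN hp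
  -- the force family on `ℤ × ℤ × ℤ`, own term `= pairForce 0 = 0`
  set F : ℤ × ℤ × ℤ → E3 := fun t => pairForce (w m - layerPoint a b w t) with hF
  have hne : ∀ x : {x : ℤ × ℤ × ℤ // x ∉ ({(m, 0, 0)} : Finset (ℤ × ℤ × ℤ))}, layerPoint a b w x.1 ≠ w m := by
    intro x h
    apply x.2
    rw [Finset.mem_singleton]
    apply hinj
    rw [h, layerPoint_self]
  let g : {x : ℤ × ℤ × ℤ // x ∉ ({(m, 0, 0)} : Finset (ℤ × ℤ × ℤ))} → Others (Layered a b w) (w m) := fun x =>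
    ⟨layerPoint a b w x.1, (Literature.Probability.Process.count_restrict_singleton_ne_zero_iff _ _).2 (layerPoint_mem x.1), hne x⟩
  have hg : Function.Injective g := by
    intro x y h
    have h' : layerPoint a b w x.1 = layerPoint a b w y.1 := congrArg (fun q : Others (Layered a b w) (w m) => (q : E3)) h
    exact Subtype.ext (hinj h')
  have hrange : ∀ q : Others (Layered a b w) (w m), q ∉ Set.range g → pairForce (w m - (q : E3)) = 0 := by
    intro q hq
    exfalso
    apply hq
    obtain ⟨l, i, j, hq'⟩ := mem_of_others q
    have ht : (l, i, j) ∉ ({(m, 0, 0)} : Finset (ℤ × ℤ × ℤ)) := by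
      rw [Finset.mem_singleton]
      intro h
      apply q.2.2
      rw [hq', ← layerPoint_self (a := a) (b := b) (w := w) m, ← h]
      rfl
    exact ⟨⟨(l, i, j), ht⟩, Subtype.ext hq'.symm⟩
  have h1 : HasSum ((fun q : Others (Layered a b w) (w m) => pairForce (w m - (q : E3))) ∘ g) 0 :=
    (hg.hasSum_iff hrange).mpr hbal
  have h2 : HasSum (fun x : {x : ℤ × ℤ × ℤ // x ∉ ({(m, 0, 0)} : Finset (ℤ × ℤ × ℤ))} => F x) 0 := h1
  have h3 : HasSum F 0 := by
    have := (Finset.hasSum_compl_iff ({(m, 0, 0)} : Finset (ℤ × ℤ × ℤ))).mp h2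
    simpa [hF, layerPoint_self, pairForce_zero] using this
  -- fibres: layer `l` contributes `layerForce a b (w m − w l)`
  have hfib : ∀ l : ℤ, HasSum (fun c : ℤ × ℤ => F (l, c)) (layerForce a b (w m - w l)) := by
    intro l
    have hsum : Summable fun c : ℤ × ℤ => F (l, c) := h3.summable.prod_factor l
    have heq : ∑' c : ℤ × ℤ, F (l, c) = layerForce a b (w m - w l) := by
      rw [layerForce, ← Equiv.tsum_eq (Equiv.neg (ℤ × ℤ))]
      refine tsum_congr fun c => ?_
      simp only [hF, layerPoint, Equiv.neg_apply, Prod.fst_neg, Prod.snd_neg, Int.cast_neg, neg_smul]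
      congr 1
      abel
    rw [← heq]
    exact hsum.hasSum
  have h4 : HasSum (fun l : ℤ => layerForce a b (w m - w l)) 0 := h3.prod_fiberwise hfib
  -- drop the own layer (`layerForce a b 0 = 0`)
  have hsupp : Function.support (fun l : ℤ => layerForce a b (w m - w l)) ⊆ {l | l ≠ m} := by
    intro l hl
    simp only [Function.mem_support, ne_eq] at hl
    intro h
    apply hl
    rw [h, sub_self, h0]
  exact (hasSum_subtype_iff_of_support_subset hsupp).mpr h4

end Layers

end Summit.AtomisticToContinuum.Crystallization.Theorems.ChartedPlanarOrderNashForceBalance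

end
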